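import Mathlib
import Literature.AlgebraicGeometry.Resolution.VertexDissolution
import HarnessLib

/-!
# Initial forms at a vertex: independence of the supporting line, stability under far dissolutions

Topic: `Literature/AlgebraicGeometry/Resolution`. Two bookkeeping facts about Hironaka's
vertex initial forms `in_v(J)` (Cossart–Jannsen–Saito, LNM 2270, Definition 8.2 (2) and
Lemma 8.3 (3)–(4): `in_v(g)` is attached to the VERTEX `v`, i.e. does not depend on the face
`E_L` through `v` used to cut it out; Lemma 11.4 (1): dissolutions at vertices `≠ v` do not
change `v` and its initial forms; Cossart–Piltant 2008, p. 12: "to get `Δ(E; u₁, v₂; w)` prepared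
without changing `in_v(E)`"), in the expansion-free language of `WeightedInitialForms`:

* `weight_levelWeight_eq_iff_spt` — on exponents of `y`-degree `< μ`, the level weight equals
  `w₀ μ` iff the scaled point lies on the line `p₁ x₁ + p₂ x₂ = w₀`;
* `inForm_eq_of_same_vertex` — if two positive level weights `w, w̃` both support `pts c J μ`
  and cut it exactly at the single scaled point `(a, b)`, then `in_w(f) = in_w̃(f)` in the
  degrees of `Y^μ` for every `f ∈ J`; hence `isSolvableAt_iff_of_same_vertex`;
* `isInForm_shiftZ_iff_far`, `inForm_shiftZ_far`, `isSolvableAt_shiftZ_iff_far` — a dissolution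
  `y ↦ y + λ u^v` with `u^v` of weight `> w₀` changes neither the initial forms in any degree nor
  the solvability along `w`.

No facts.

## Sources

* V. Cossart, U. Jannsen, S. Saito, LNM 2270 (2020), Def. 8.2, Lemma 8.3, Lemma 11.4 (1).
  [CossartJannsenSaito2020]
* V. Cossart, O. Piltant, J. Algebra 320 (2008), proof of Lemma 4.5, p. 12. [CossartPiltant2008]
-/

noncomputable section

open IsLocalRing MvPolynomial

namespace Literature.AlgebraicGeometry.Resolution

universe u

variable {R : Type u} [CommRing R]

/-! ## Level weights and the line -/

/-- For a level weight, an exponent of `y`-degree `≥ μ` has level weight `w₀ μ` iff it is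
`(μ, 0, 0)` (positive `w₀, p₁, p₂`). [folklore] -/
theorem weight_levelWeight_eq_iff_of_le {μ w₀ p₁ p₂ : ℕ} (hw₀ : 0 < w₀) (hp₁ : 0 < p₁)
    (hp₂ : 0 < p₂) {e : Fin 3 →₀ ℕ} (he : μ ≤ e 0) :
    Finsupp.weight (levelWeight μ w₀ p₁ p₂) e = w₀ * μ ↔ e = Finsupp.single 0 μ := by
  rw [weight_levelWeight]
  constructor
  · intro h
    have h0 : w₀ * μ ≤ w₀ * e 0 := Nat.mul_le_mul_left _ he
    have hrest : μ.factorial * (p₁ * e 1 + p₂ * e 2) = 0 := by omega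
    have h12 : p₁ * e 1 + p₂ * e 2 = 0 := by
      rcases Nat.eq_zero_or_pos (p₁ * e 1 + p₂ * e 2) with h' | h'
      · exact h'
      · exact absurd hrest (Nat.mul_pos (Nat.factorial_pos μ) h').ne'
    have he1 : e 1 = 0 := by
      rcases Nat.eq_zero_or_pos (e 1) with h' | h'
      · exact h'
      · have := Nat.mul_pos hp₁ h'; omega
    have he2 : e 2 = 0 := by
      rcases Nat.eq_zero_or_pos (e 2) with h' | h'
      · exact h'
      · have := Nat.mul_pos hp₂ h'; omega
    have he0 : e 0 = μ := by
      have : w₀ * e 0 = w₀ * μ := by omega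
      exact Nat.eq_of_mul_eq_mul_left hw₀ this
    ext i
    fin_cases i
    · simpa using he0
    · simpa using he1
    · simpa using he2
  · rintro rfl
    simp

/-- **On exponents of `y`-degree `< μ`, the level weight is `w₀ μ` iff the scaled point lies on
the line `p₁ x₁ + p₂ x₂ = w₀`.** [cite: CossartJannsenSaito2020, Remark 8.9 (2)] -/
theorem weight_levelWeight_eq_iff_spt {μ : ℕ} {e : Fin 3 →₀ ℕ} (he : e 0 < μ) (w₀ p₁ p₂ : ℕ) :
    Finsupp.weight (levelWeight μ w₀ p₁ p₂) e = w₀ * μ ↔ p₁ * spt₁ μ e + p₂ * spt₂ μ e = w₀ := by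
  rw [weight_levelWeight, factorial_mul_eq_sub_mul he]
  obtain ⟨d, hd, hμ⟩ : ∃ d, 0 < d ∧ μ = e 0 + d := ⟨μ - e 0, by omega, by omega⟩
  have hsub : μ - e 0 = d := by omega
  rw [hsub]
  have hμ' : w₀ * μ = w₀ * e 0 + w₀ * d := by rw [hμ, Nat.mul_add]
  constructor
  · intro h
    have h' : d * (p₁ * spt₁ μ e + p₂ * spt₂ μ e) = d * w₀ := by rw [mul_comm d w₀]; omega
    exact Nat.eq_of_mul_eq_mul_left hd h'
  · intro h; rw [h, hμ']; ring

/-! ## Independence of the supporting line -/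

section SameVertex

variable [IsRegularLocalRing R] (c : Fin 3 → R)
  (hgen : Ideal.span {c 0, c 1, c 2} = maximalIdeal R) (hdim : ringKrullDim R = 3)
  {J : Ideal R} {μ : ℕ}

include hgen hdim in
/-- The reduction of the level component of a fine unit representative is the initial form.
[cite: CossartJannsenSaito2020, Def. 8.2] -/
theorem inForm_eq_map_component {w : Fin 3 → ℕ} (hw : ∀ i, 0 < w i) {n N : ℕ} (hnN : n + 1 ≤ N)
    {f : R} {F : MvPolynomial (Fin 3) R} (hFrem : f - eval c F ∈ weightedIdealW c w N)
    (hmin : ∀ m ∈ F.support, n ≤ Finsupp.weight w m) :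
    inForm c w n f = MvPolynomial.map (residue R) (weightedHomogeneousComponent w n F) := by
  have hf : f ∈ weightedIdealW c w n := by
    have h1 : eval c F ∈ weightedIdealW c w n := eval_mem_weightedIdealW_of_forall_le c w hmin
    have h2 := weightedIdealW_antitone c w (by omega : n ≤ N) hFrem
    have : f = (f - eval c F) + eval c F := by ring
    rw [this]; exact Ideal.add_mem _ h2 h1
  have hIn : IsInForm c w n f (MvPolynomial.map (residue R) (weightedHomogeneousComponent w n F)) := by
    refine ⟨weightedHomogeneousComponent w n F, weightedHomogeneousComponent_isWeightedHomogeneous n F,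
      rfl, ?_⟩
    have h3 := eval_sub_component_mem c w hmin
    have : f - eval c (weightedHomogeneousComponent w n F) =
        (f - eval c F) + eval c (F - weightedHomogeneousComponent w n F) := by rw [map_sub]; ring
    rw [this]
    exact Ideal.add_mem _ (weightedIdealW_antitone c w hnN hFrem) h3
  exact (hIn.eq_inForm c hgen hdim hw).symm

include hgen hdim in
/-- **The initial form at a vertex does not depend on the supporting line**: let `w = (w₀, Lp₁,
Lp₂)` and `w̃ = (q₀, Lq₁, Lq₂)` be positive level weights whose lines contain the scaled point
`(a, b)`, both half-planes containing `pts c J μ` and both lines meeting it only at `(a, b)`. Then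
for `f ∈ J`, `in_w(f)` in degree `w₀ μ` equals `in_w̃(f)` in degree `q₀ μ`.
[cite: CossartJannsenSaito2020, Lemma 8.3 (3)–(4)] [cite: CossartPiltant2008, proof of Lemma 4.5, p. 12] -/
theorem inForm_eq_of_same_vertex {w₀ p₁ p₂ q₀ q₁ q₂ a b : ℕ} (hw₀ : 0 < w₀) (hp₁ : 0 < p₁)
    (hp₂ : 0 < p₂) (hq₀ : 0 < q₀) (hq₁ : 0 < q₁) (hq₂ : 0 < q₂)
    (hline : p₁ * a + p₂ * b = w₀) (hline' : q₁ * a + q₂ * b = q₀)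
    (hS : ∀ e ∈ pts c J μ, w₀ ≤ p₁ * spt₁ μ e + p₂ * spt₂ μ e)
    (hS' : ∀ e ∈ pts c J μ, q₀ ≤ q₁ * spt₁ μ e + q₂ * spt₂ μ e)
    (huniq : ∀ e ∈ pts c J μ, p₁ * spt₁ μ e + p₂ * spt₂ μ e = w₀ → spt₁ μ e = a ∧ spt₂ μ e = b)
    (huniq' : ∀ e ∈ pts c J μ, q₁ * spt₁ μ e + q₂ * spt₂ μ e = q₀ → spt₁ μ e = a ∧ spt₂ μ e = b)
    {f : R} (hf : f ∈ J) :
    inForm c (levelWeight μ w₀ p₁ p₂) (w₀ * μ) f = inForm c (levelWeight μ q₀ q₁ q₂) (q₀ * μ) f := by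
  classical
  have hw : ∀ i, 0 < levelWeight μ w₀ p₁ p₂ i := levelWeight_pos hw₀ hp₁ hp₂
  have hw' : ∀ i, 0 < levelWeight μ q₀ q₁ q₂ i := levelWeight_pos hq₀ hq₁ hq₂
  have hgenr := span_range_eq_of_span_triple c hgen
  have hJw : J ≤ weightedIdealW c (levelWeight μ w₀ p₁ p₂) (w₀ * μ) :=
    (le_weightedIdealW_levelWeight_iff c hgen hdim J hw₀ hp₁ hp₂).mpr hS
  have hJw' : J ≤ weightedIdealW c (levelWeight μ q₀ q₁ q₂) (q₀ * μ) :=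
    (le_weightedIdealW_levelWeight_iff c hgen hdim J hq₀ hq₁ hq₂).mpr hS'
  -- a fine unit representative of `f`
  set N := w₀ * μ + q₀ * μ + 1 with hN
  obtain ⟨F, hFu, -, hFrem⟩ := exists_unitRep c hgenr f N
  have hremw : f - eval c F ∈ weightedIdealW c (levelWeight μ w₀ p₁ p₂) N :=
    pow_maximalIdeal_le_weightedIdealW c hgenr hw N hFrem
  have hremw' : f - eval c F ∈ weightedIdealW c (levelWeight μ q₀ q₁ q₂) N :=
    pow_maximalIdeal_le_weightedIdealW c hgenr hw' N hFrem
  have hminw : ∀ m ∈ F.support, w₀ * μ ≤ Finsupp.weight (levelWeight μ w₀ p₁ p₂) m :=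
    (mem_weightedIdealW_iff_of_unitRep c hgen hdim hw hFu hremw (by omega)).mp (hJw hf)
  have hminw' : ∀ m ∈ F.support, q₀ * μ ≤ Finsupp.weight (levelWeight μ q₀ q₁ q₂) m :=
    (mem_weightedIdealW_iff_of_unitRep c hgen hdim hw' hFu hremw' (by omega)).mp (hJw' hf)
  -- the two level conditions agree on the support of `F`
  have hkey : ∀ m ∈ F.support, (Finsupp.weight (levelWeight μ w₀ p₁ p₂) m = w₀ * μ ↔
      Finsupp.weight (levelWeight μ q₀ q₁ q₂) m = q₀ * μ) := by
    intro m hm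
    by_cases hm0 : μ ≤ m 0
    · rw [weight_levelWeight_eq_iff_of_le hw₀ hp₁ hp₂ hm0,
        weight_levelWeight_eq_iff_of_le hq₀ hq₁ hq₂ hm0]
    · push Not at hm0
      rw [weight_levelWeight_eq_iff_spt hm0, weight_levelWeight_eq_iff_spt hm0]
      constructor
      · intro hwt
        have hwm : Finsupp.weight (levelWeight μ w₀ p₁ p₂) m = w₀ * μ :=
          (weight_levelWeight_eq_iff_spt hm0 w₀ p₁ p₂).mpr hwt
        have hinit : IsInitialTerm c (levelWeight μ w₀ p₁ p₂) f m := by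
          refine (isInitialTerm_iff_of_unitRep c hgen hdim hw hFu hremw (by omega)).mpr ⟨hm, ?_⟩
          intro m' hm'
          rw [hwm]
          exact hminw m' hm'
        obtain ⟨ha, hb⟩ := huniq m ⟨mem_occ_of_isInitialTerm c hf hw hinit, hm0⟩ hwt
        rw [ha, hb, hline']
      · intro hwt
        have hwm : Finsupp.weight (levelWeight μ q₀ q₁ q₂) m = q₀ * μ :=
          (weight_levelWeight_eq_iff_spt hm0 q₀ q₁ q₂).mpr hwt
        have hinit : IsInitialTerm c (levelWeight μ q₀ q₁ q₂) f m := by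
          refine (isInitialTerm_iff_of_unitRep c hgen hdim hw' hFu hremw' (by omega)).mpr ⟨hm, ?_⟩
          intro m' hm'
          rw [hwm]
          exact hminw' m' hm'
        obtain ⟨ha, hb⟩ := huniq' m ⟨mem_occ_of_isInitialTerm c hf hw' hinit, hm0⟩ hwt
        rw [ha, hb, hline]
  -- hence the level components coincide
  have hcomp : weightedHomogeneousComponent (levelWeight μ w₀ p₁ p₂) (w₀ * μ) F =
      weightedHomogeneousComponent (levelWeight μ q₀ q₁ q₂) (q₀ * μ) F := by
    ext m
    rw [coeff_weightedHomogeneousComponent, coeff_weightedHomogeneousComponent]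
    by_cases hm : m ∈ F.support
    · by_cases h1 : Finsupp.weight (levelWeight μ w₀ p₁ p₂) m = w₀ * μ
      · rw [if_pos h1, if_pos ((hkey m hm).mp h1)]
      · rw [if_neg h1, if_neg (fun h2 => h1 ((hkey m hm).mpr h2))]
    · rw [notMem_support_iff.mp hm]; split_ifs <;> rfl
  rw [inForm_eq_map_component c hgen hdim hw (by omega) hremw hminw,
    inForm_eq_map_component c hgen hdim hw' (by omega) hremw' hminw', hcomp]

include hgen hdim in
/-- **Solvability of a vertex does not depend on the supporting line** (same hypotheses, and
`(a, b) = L (v₁, v₂)`). [cite: CossartJannsenSaito2020, Def. 8.11, Lemma 8.3] -/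
theorem isSolvableAt_iff_of_same_vertex {w₀ p₁ p₂ q₀ q₁ q₂ v₁ v₂ : ℕ} (hw₀ : 0 < w₀)
    (hp₁ : 0 < p₁) (hp₂ : 0 < p₂) (hq₀ : 0 < q₀) (hq₁ : 0 < q₁) (hq₂ : 0 < q₂)
    (hline : p₁ * (μ.factorial * v₁) + p₂ * (μ.factorial * v₂) = w₀)
    (hline' : q₁ * (μ.factorial * v₁) + q₂ * (μ.factorial * v₂) = q₀)
    (hS : ∀ e ∈ pts c J μ, w₀ ≤ p₁ * spt₁ μ e + p₂ * spt₂ μ e)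
    (hS' : ∀ e ∈ pts c J μ, q₀ ≤ q₁ * spt₁ μ e + q₂ * spt₂ μ e)
    (huniq : ∀ e ∈ pts c J μ, p₁ * spt₁ μ e + p₂ * spt₂ μ e = w₀ →
      spt₁ μ e = μ.factorial * v₁ ∧ spt₂ μ e = μ.factorial * v₂)
    (huniq' : ∀ e ∈ pts c J μ, q₁ * spt₁ μ e + q₂ * spt₂ μ e = q₀ →
      spt₁ μ e = μ.factorial * v₁ ∧ spt₂ μ e = μ.factorial * v₂)
    (lam : ResidueField R) :
    IsSolvableAt c J (levelWeight μ w₀ p₁ p₂) (w₀ * μ) μ (vexp v₁ v₂) lam ↔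
      IsSolvableAt c J (levelWeight μ q₀ q₁ q₂) (q₀ * μ) μ (vexp v₁ v₂) lam := by
  have hJw : J ≤ weightedIdealW c (levelWeight μ w₀ p₁ p₂) (w₀ * μ) :=
    (le_weightedIdealW_levelWeight_iff c hgen hdim J hw₀ hp₁ hp₂).mpr hS
  have hJw' : J ≤ weightedIdealW c (levelWeight μ q₀ q₁ q₂) (q₀ * μ) :=
    (le_weightedIdealW_levelWeight_iff c hgen hdim J hq₀ hq₁ hq₂).mpr hS'
  have hvw : Finsupp.weight (levelWeight μ w₀ p₁ p₂) (vexp v₁ v₂) = levelWeight μ w₀ p₁ p₂ 0 := by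
    rw [weight_vexp]; simp only [levelWeight_zero, levelWeight_one, levelWeight_two]; rw [← hline]; ring
  have hvw' : Finsupp.weight (levelWeight μ q₀ q₁ q₂) (vexp v₁ v₂) = levelWeight μ q₀ q₁ q₂ 0 := by
    rw [weight_vexp]; simp only [levelWeight_zero, levelWeight_one, levelWeight_two]; rw [← hline']; ring
  unfold IsSolvableAt
  simp only [vexp_zero, hvw, hvw', true_and]
  constructor
  · intro h f hfJ _
    obtain ⟨a, ha⟩ := h f hfJ (hJw hfJ)
    exact ⟨a, by rw [← inForm_eq_of_same_vertex c hgen hdim hw₀ hp₁ hp₂ hq₀ hq₁ hq₂ hline hline'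
      hS hS' huniq huniq' hfJ, ha]⟩
  · intro h f hfJ _
    obtain ⟨a, ha⟩ := h f hfJ (hJw' hfJ)
    exact ⟨a, by rw [inForm_eq_of_same_vertex c hgen hdim hw₀ hp₁ hp₂ hq₀ hq₁ hq₂ hline hline'
      hS hS' huniq huniq' hfJ, ha]⟩

end SameVertex

/-! ## Stability under far dissolutions -/

section Far

variable (c : Fin 3 → R) (lam : R) {v₁ v₂ : ℕ}

/-- **Initial forms are unchanged by a far dissolution** (one direction): if the shift monomial
`u^v` has `w`-weight `> w₀`, a `w`-initial form witness for `c` is one for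
`c′ = (y + λ u^v, u)`. [cite: CossartJannsenSaito2020, Lemma 11.4 (1)] -/
theorem IsInForm.shiftZ_far [IsLocalRing R] {w : Fin 3 → ℕ} (hfar : w 0 + 1 ≤ v₁ * w 1 + v₂ * w 2)
    {n : ℕ} {f : R} {P : MvPolynomial (Fin 3) (ResidueField R)} (h : IsInForm c w n f P) :
    IsInForm (shiftZ c (shiftMon c lam v₁ v₂)) w n f P := by
  obtain ⟨G, hG, hGP, hGrem⟩ := h
  refine ⟨G, hG, hGP, ?_⟩
  set t := shiftMon c lam v₁ v₂ with htdef
  have htmem : ∀ y : R, ∀ ρ, ρ ≤ v₁ * w 1 + v₂ * w 2 → t ∈ weightedIdealW ![y, c 1, c 2] w ρ := by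
    intro y ρ hρ
    rw [htdef, shiftMon]
    refine Ideal.mul_mem_left _ _ ?_
    have : c 1 ^ v₁ * c 2 ^ v₂ = monom3 ![y, c 1, c 2] (vexp v₁ v₂) := by simp [monom3]
    rw [this]
    refine monomial_mem_weightedIdealW _ w ?_
    rw [weight_vexp]; exact hρ
  have ht : t ∈ weightedIdealW c w (w 0 + 1) := by
    have := htmem (c 0) _ hfar; rwa [eta_fin_three] at this
  have ht'' : t ∈ weightedIdealW c w (w 0) := weightedIdealW_antitone c w (Nat.le_succ _) ht
  have ht' : t ∈ weightedIdealW (shiftZ c t) w (w 0) := htmem _ _ (by omega)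
  have hWeq : weightedIdealW (shiftZ c t) w (n + 1) = weightedIdealW c w (n + 1) := by
    have := weightedIdealW_shift_z (c 0) (c 1) (c 2) t w ht'' ht' (n + 1)
    rw [eta_fin_three] at this; exact this
  rw [hWeq]
  have hsub := eval_sub_eval_shiftZ_mem c ht ht' ht'' hG
  have : f - eval (shiftZ c t) G = (f - eval c G) + (eval c G - eval (shiftZ c t) G) := by ring
  rw [this]; exact Ideal.add_mem _ hGrem hsub

/-- Shifting back by the opposite monomial. [folklore] -/
theorem shiftZ_shiftMon_neg : shiftZ (shiftZ c (shiftMon c lam v₁ v₂))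
    (shiftMon (shiftZ c (shiftMon c lam v₁ v₂)) (-lam) v₁ v₂) = c := by
  funext i
  fin_cases i
  · show c 0 + lam * (c 1 ^ v₁ * c 2 ^ v₂) + -lam * (c 1 ^ v₁ * c 2 ^ v₂) = c 0
    ring
  · rfl
  · rfl

/-- **Initial forms are unchanged by a far dissolution.** [cite: CossartJannsenSaito2020, Lemma 11.4 (1)] -/
theorem isInForm_shiftZ_iff_far [IsLocalRing R] {w : Fin 3 → ℕ}
    (hfar : w 0 + 1 ≤ v₁ * w 1 + v₂ * w 2) (n : ℕ) (f : R)
    (P : MvPolynomial (Fin 3) (ResidueField R)) :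
    IsInForm (shiftZ c (shiftMon c lam v₁ v₂)) w n f P ↔ IsInForm c w n f P := by
  refine ⟨fun h => ?_, IsInForm.shiftZ_far c lam hfar⟩
  have := h.shiftZ_far (shiftZ c (shiftMon c lam v₁ v₂)) (-lam) hfar
  rwa [shiftZ_shiftMon_neg] at this

variable [IsRegularLocalRing R] (hgen : Ideal.span {c 0, c 1, c 2} = maximalIdeal R)
  (hdim : ringKrullDim R = 3)

include hgen hdim in
/-- `inForm` is unchanged by a far dissolution (positive weights, `f ∈ F_n`, `v ≠ 0`).
[cite: CossartJannsenSaito2020, Lemma 11.4 (1)] -/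
theorem inForm_shiftZ_far {w : Fin 3 → ℕ} (hwpos : ∀ i, 0 < w i) (hv : 0 < v₁ + v₂)
    (hfar : w 0 + 1 ≤ v₁ * w 1 + v₂ * w 2) {n : ℕ} {f : R} (hf : f ∈ weightedIdealW c w n) :
    inForm (shiftZ c (shiftMon c lam v₁ v₂)) w n f = inForm c w n f := by
  have hgen' : Ideal.span {shiftZ c (shiftMon c lam v₁ v₂) 0, shiftZ c (shiftMon c lam v₁ v₂) 1,
      shiftZ c (shiftMon c lam v₁ v₂) 2} = maximalIdeal R := by
    rw [span_triple_shiftZ c lam hv]; exact hgen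
  have h := (isInForm_inForm c hgen hdim hwpos hf).shiftZ_far c lam hfar
  exact (h.eq_inForm _ hgen' hdim hwpos).symm

include hgen hdim in
/-- **Solvability along `w` is unchanged by a far dissolution** (CJS Lemma 11.4 (1): preparing
at vertices beyond `v` keeps `v` and `in_v`). [cite: CossartJannsenSaito2020, Lemma 11.4 (1)]
[cite: CossartPiltant2008, proof of Lemma 4.5, p. 12] -/
theorem isSolvableAt_shiftZ_iff_far {J : Ideal R} {w : Fin 3 → ℕ} (hwpos : ∀ i, 0 < w i)
    (hv : 0 < v₁ + v₂) (hfar : w 0 + 1 ≤ v₁ * w 1 + v₂ * w 2) {n μ : ℕ} {v : Fin 3 →₀ ℕ}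
    {lam' : ResidueField R} :
    IsSolvableAt (shiftZ c (shiftMon c lam v₁ v₂)) J w n μ v lam' ↔ IsSolvableAt c J w n μ v lam' := by
  unfold IsSolvableAt
  refine and_congr_right fun _ => and_congr_right fun _ => ?_
  refine forall_congr' fun f => forall_congr' fun hfJ => ?_
  rw [weightedIdealW_shiftZ c lam w (by omega)]
  refine forall_congr' fun hfn => ?_
  rw [inForm_shiftZ_far c lam hgen hdim hwpos hv hfar hfn]

end Far

end Literature.AlgebraicGeometry.Resolution
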